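import Summits.QuantumFields.BalabanUV.Beta.D1BFx.RJetAssembly
import Summits.QuantumFields.BalabanUV.Beta.D1BFx.GhostKernel
import Literature.MathematicalPhysics.QuantumFieldTheory.Balaban1983to89.Beta.BalabanStepJets

/-!
# D1 · BF-x road · T4 — the BF first-order fine stencil `Sbf` (typer object, SCOPED v1)

HONEST DEPENDENCY: continuum YM on T⁴ ⇐ BetaPertH ∧ nine spine estimates (0/9 proved); BetaPertH ⇐ (D1) ∧ (D4) ∧ CAP+tail;
G-an2-4 gates asym, D1 and NE2/3/4.  HONEST FRAMING: discharging BetaPertH makes Balaban's UV stability UNCONDITIONAL —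
NOT the continuum limit and NOT the Clay problem.  THIS FILE is kernel bookkeeping for ONE road (BF-x) to ONE conjunct (D1):
a block restriction and a sum of two LANDED stencil families, with their two sockets (bi-localisation, block covariance)
discharged BY NAME.  It proves no estimate of the programme, has 0 wall binders, and asserts nothing (`def`s of data + lemmas).

WHAT IS HERE (typer object T4 of `TYPER-SPEC-D1BFx.md` §1, scoped as stamped under row T4 of `LEAVES-BFx.md`):
* §1 [our object] `ffOf : MKer 4 (Fib 3) → MKer 4 (Fin 4)` — the field–field block of a bordered (`Fib 3 = Fin 4 ⊕ Fin 4`) kernel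
  (K-R2: the blocks of the bordered resolvent ARE the reduced formulas entrywise, so the road reads the ff-block); linear, commutes
  with `shiftK`, transports `Decays`/`BiLoc`/`LocStencil`; the VH sector of an2's `S₀` has NO ff-block (`ffOf_mfNeg_vhS`).
* §2 [our object] `SbfOf S cR R Ṙ κ′ u := ffOf (S κ′ u) + cR • RjetOf R Ṙ κ′ u` for ANY bordered first-order family `S` and ANY
  J5 data `(R, Ṙ)` (leaf-05-g3's `RJetAssembly.RjetOf`), with the sockets EXACTLY in the consumers' binder shapes:
  `biLoc_SbfOf` (feeds T8 `ReducedKernel.vertexFamily_vertexRed′`), `SbfOf_translate_block` (feeds leaf-04's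
  `GhostKernel.vertexRedF_translate_block`), `SbfOf_antisymm`.
* §3 THE ROAD INSTANCE `Sbf n cE cVH cΛ cR R Ṙ := SbfOf (BalabanStepJets.S0 3 n cE cVH cΛ) cR R Ṙ`: the E-sector `cE • wilsonA 3`
  and the Λ-sector `cΛ • SLam n (lamCoeffOf (KInv n) n) (hessFF n)` enter BY NAME through an2's `S0` exactly as TYPER-SPEC §0 names
  them; `Sbf_eq_sectors` displays the three sectors and `Sbf_indep_cVH` records that `Sbf` is `cVH`-free (proved, not assumed);
  sockets `exists_biLoc_Sbf`, `Sbf_translate_block`, `Sbf_antisymm`; T8 plugs `exists_vertexFamily_vertexRed_Sbf`,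
  `vertexRed_Sbf_translate`, `blockCovariant_vertexRed_Sbf`.

NOT IN v1 (flagged, not minted): the J6 sector `cQ • a·(Q′ᵀ_{κ′u} Q_n + Q_nᵀ Q′_{κ′u})` — whether it is a FINE-STENCIL addend of
`Sbf` (TYPER-SPEC §1-T4) or one of the BLOCK-STRUCTURED terms of K-R2 CONSEQUENCE is the row owner's (beta-d1-p2) ruling; v2 adds
`+ cQ • SQ6 n a κ′ u` once ruled.  The ROAD `(R, Ṙ)` — leaf-05-g3's `RJetProjector.Rgt n a` and leaf-07-g2's `RProjectorJet.Rdot n a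
cK cQ` — plug into the binders `R`, `Ṙ` BY NAME with exactly J5-asm's hypothesis shapes (`Decays R C δ`, `shiftK (−(n•t)) R = R`,
`BiLoc (Ṙ κ′ u) u u C′ δ`, `Ṙ κ′ (u + n•t) = shiftK (−(n•t)) (Ṙ κ′ u)`, symmetry of `R`, antisymmetry of `Ṙ κ′ u` — the
`R`-periodicity in the suppliers' sign convention `shiftK (−(n•t)) R = R`, as `GluonLeg.shiftK_Ga_neg` / `RProjectorJet.Rdot_translate`).

All statements are [folklore] finite bookkeeping or [our object] definitions; 0 `cite`, no `def … : Prop`.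
-/

noncomputable section

open Finset
open Literature.MathematicalPhysics.QuantumFieldTheory.Balaban1983to89
open Literature.MathematicalPhysics.QuantumFieldTheory.Balaban1983to89.Beta
open B12Sec2to5 (l1 l1_nonneg)
open ExpKernelCalculus (Site MKer Decays BiLoc VertexFamily BlockCovariant shiftK)
open OneStepResolventKernel (Fib LocStencil KInv)
open StepJetData (wilsonA mfNeg)
open AveragingHessianKernels (vhS hessFF)
open InterLevelTransport (SLam)
open BalabanStepJets (S0 lamCoeffOf locStencil_S0 S0_translate S0_antisymm)
open Summit.QuantumFields.BalabanUV.Beta.D1BFx.GluonLeg (Ga blockCovariant_Ga)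
open Summit.QuantumFields.BalabanUV.Beta.D1BFx.ReducedKernel (StencilR vertexRed vertexFamily_vertexRed')
open Summit.QuantumFields.BalabanUV.Beta.D1BFx.ReducedKernelF (vertexRedF)
open Summit.QuantumFields.BalabanUV.Beta.D1BFx.GhostKernel (vertexRedF_translate_block)
open Summit.QuantumFields.BalabanUV.Beta.D1BFx.RJetAssembly (RjetOf biLoc_RjetOf RjetOf_translate RjetOf_antisymm)

namespace Summit.QuantumFields.BalabanUV.Beta.D1BFx.FineStencilBF

/-! ## §1 The field–field block of a bordered kernel -/

/-- [our object] The field–field (`inl`–`inl`) block of a kernel on the bordered fibre `Fib 3 = Fin 4 ⊕ Fin 4`.  A definition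
asserting nothing. -/
def ffOf (K : MKer 4 (Fib 3)) : MKer 4 (Fin 4) := fun x z α β => K x z (Sum.inl α) (Sum.inl β)

/-- [our object] Unfolding `ffOf`. -/
@[simp] theorem ffOf_apply (K : MKer 4 (Fib 3)) (x z : Site 4) (α β : Fin 4) :
    ffOf K x z α β = K x z (Sum.inl α) (Sum.inl β) := rfl

/-- [folklore] `ffOf 0 = 0`. -/
@[simp] theorem ffOf_zero : ffOf (0 : MKer 4 (Fib 3)) = 0 := rfl

/-- [folklore] `ffOf` is additive. -/
@[simp] theorem ffOf_add (K K' : MKer 4 (Fib 3)) : ffOf (K + K') = ffOf K + ffOf K' := rfl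

/-- [folklore] `ffOf` respects subtraction. -/
@[simp] theorem ffOf_sub (K K' : MKer 4 (Fib 3)) : ffOf (K - K') = ffOf K - ffOf K' := rfl

/-- [folklore] `ffOf` respects negation. -/
@[simp] theorem ffOf_neg (K : MKer 4 (Fib 3)) : ffOf (-K) = -ffOf K := rfl

/-- [folklore] `ffOf` is homogeneous. -/
@[simp] theorem ffOf_smul (c : ℝ) (K : MKer 4 (Fib 3)) : ffOf (c • K) = c • ffOf K := rfl

/-- [folklore] `ffOf` is additive over finite sums. -/
theorem ffOf_sum {ι : Type*} (s : Finset ι) (K : ι → MKer 4 (Fib 3)) : ffOf (∑ i ∈ s, K i) = ∑ i ∈ s, ffOf (K i) := by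
  funext x z α β
  simp only [ffOf_apply, Finset.sum_apply]

/-- [folklore] `ffOf` commutes with translations. -/
theorem ffOf_shiftK (v : Site 4) (K : MKer 4 (Fib 3)) : ffOf (shiftK v K) = shiftK v (ffOf K) := rfl

/-- [folklore] Off-diagonal decay passes to the ff-block. -/
theorem decays_ffOf {K : MKer 4 (Fib 3)} {C δ : ℝ} (h : Decays K C δ) : Decays (ffOf K) C δ :=
  fun x z α β => h x z (Sum.inl α) (Sum.inl β)

/-- [folklore] Bi-localisation passes to the ff-block (same centres, constant and rate). -/
theorem biLoc_ffOf {K : MKer 4 (Fib 3)} {p q : Site 4} {C δ : ℝ} (h : BiLoc K p q C δ) : BiLoc (ffOf K) p q C δ :=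
  fun x z α β => h x z (Sum.inl α) (Sum.inl β)

/-- [folklore] A `LocStencil` family restricts to a bi-localised `Fin 4`-family, in T8's binder shape `∀ κ′ u, BiLoc (S κ′ u) u u C δ`. -/
theorem biLoc_ffOf_of_locStencil {S : Fin 4 → Site 4 → MKer 4 (Fib 3)} {C δ : ℝ} (h : LocStencil S C δ) (κ' : Fin 4)
    (u : Site 4) : BiLoc (ffOf (S κ' u)) u u C δ :=
  biLoc_ffOf (h κ' u)

/-- [folklore] Antisymmetry on the packed fibre (`K z x b a = −K x z a b`) restricts to antisymmetry of the ff-block. -/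
theorem ffOf_antisymm {K : MKer 4 (Fib 3)} (h : ∀ (x z : Site 4) (a b : Fib 3), K z x b a = -K x z a b) (x z : Site 4)
    (α β : Fin 4) : ffOf K z x β α = -ffOf K x z α β :=
  h x z (Sum.inl α) (Sum.inl β)

/-- [folklore] an1's field–multiplier stencil `vhS` (the packer `packVH`) has NO field–field block. -/
theorem ffOf_vhS (n : ℕ) (κ' : Fin 4) (u : Site 4) : ffOf (vhS 3 n κ' u) = 0 := by
  funext x z α β
  simp only [ffOf_apply, vhS, AveragingHessianKernels.packVH_inl_inl, Pi.zero_apply]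

/-- [folklore] … hence neither has its antisymmetrised version `mfNeg (vhS 3 n κ′ u)` (the VH sector of an2's `S₀`). -/
theorem ffOf_mfNeg_vhS (n : ℕ) (κ' : Fin 4) (u : Site 4) : ffOf (mfNeg (vhS 3 n κ' u)) = 0 := by
  funext x z α β
  simp only [ffOf_apply, StepJetData.mfNeg_inl_inl, vhS, AveragingHessianKernels.packVH_inl_inl, Pi.zero_apply]

/-! ## §2 The generic BF-x first-order stencil `SbfOf S cR R Ṙ` and its sockets -/

/-- [our object] **THE GENERIC BF-x FIRST-ORDER FINE STENCIL**: the ff-block of a bordered first-order family `S` plus `cR` times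
leaf-05-g3's R-jet `RjetOf R Ṙ` (J5).  A definition asserting nothing. -/
def SbfOf (S : Fin 4 → Site 4 → MKer 4 (Fib 3)) (cR : ℝ) (R : MKer 4 Unit) (Rd : Fin 4 → Site 4 → MKer 4 Unit) : StencilR :=
  fun κ' u => ffOf (S κ' u) + cR • RjetOf R Rd κ' u

/-- [our object] Unfolding `SbfOf`. -/
theorem SbfOf_apply (S : Fin 4 → Site 4 → MKer 4 (Fib 3)) (cR : ℝ) (R : MKer 4 Unit) (Rd : Fin 4 → Site 4 → MKer 4 Unit)
    (κ' : Fin 4) (u : Site 4) : SbfOf S cR R Rd κ' u = ffOf (S κ' u) + cR • RjetOf R Rd κ' u := rfl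

/-- [folklore] Rate monotonicity of `BiLoc` WITHOUT a sign hypothesis on the constant (a negative constant makes the hypothesis
absurd pointwise). -/
theorem biLoc_anti {F : Type*} {K : MKer 4 F} {p q : Site 4} {C δ δ' : ℝ} (h : BiLoc K p q C δ) (hδ : δ' ≤ δ) :
    BiLoc K p q C δ' := by
  intro x y a b
  have h0 := h x y a b
  have hl : 0 ≤ l1 (x - p) + l1 (y - q) := add_nonneg (l1_nonneg _) (l1_nonneg _)
  rcases le_or_gt 0 C with hC | hC
  · exact h0.trans (mul_le_mul_of_nonneg_left (Real.exp_le_exp.2 (by nlinarith)) hC)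
  · exfalso
    have h1 : C * Real.exp (-δ * (l1 (x - p) + l1 (y - q))) < 0 := mul_neg_of_neg_of_pos hC (Real.exp_pos _)
    exact absurd ((abs_nonneg _).trans h0) (not_le.2 h1)

/-- [folklore] Rate monotonicity of `Decays` without a sign hypothesis on the constant. -/
theorem decays_anti {F : Type*} {K : MKer 4 F} {C δ δ' : ℝ} (h : Decays K C δ) (hδ : δ' ≤ δ) : Decays K C δ' := by
  intro x y a b
  have h0 := h x y a b
  have hl : 0 ≤ l1 (x - y) := l1_nonneg _
  rcases le_or_gt 0 C with hC | hC
  · exact h0.trans (mul_le_mul_of_nonneg_left (Real.exp_le_exp.2 (by nlinarith)) hC)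
  · exfalso
    have h1 : C * Real.exp (-δ * l1 (x - y)) < 0 := mul_neg_of_neg_of_pos hC (Real.exp_pos _)
    exact absurd ((abs_nonneg _).trans h0) (not_le.2 h1)

/-- [folklore] **SOCKET 1 (bi-localisation), generic form** — in T8's binder shape: from `LocStencil S Cs δ`, `Decays R C δ` and
`BiLoc (Ṙ κ′ u) u u C′ δ` at ONE common rate `δ ≥ 0` (use `biLoc_anti`/`decays_anti` to match rates),
`BiLoc (SbfOf S cR R Ṙ κ′ u) u u (Cs + |cR|·4(C+C′)e^{2δ}) δ` (leaf-05-g3's `biLoc_RjetOf` BY NAME). -/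
theorem biLoc_SbfOf {S : Fin 4 → Site 4 → MKer 4 (Fib 3)} {cR : ℝ} {R : MKer 4 Unit} {Rd : Fin 4 → Site 4 → MKer 4 Unit}
    {Cs C C' δ : ℝ} (hδ : 0 ≤ δ) (hS : LocStencil S Cs δ) (hR : Decays R C δ) (hRd : ∀ κ' u, BiLoc (Rd κ' u) u u C' δ)
    (κ' : Fin 4) (u : Site 4) : BiLoc (SbfOf S cR R Rd κ' u) u u (Cs + |cR| * (4 * (C + C') * Real.exp (2 * δ))) δ :=
  KernelWard.biLoc_add (biLoc_ffOf (hS κ' u)) (StepJetData.biLoc_smul (biLoc_RjetOf κ' u hδ hR (hRd κ' u)) cR)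

/-- [folklore] **SOCKET 2 (block covariance), generic form** — in the binder shape of leaf-04's `GhostKernel.vertexRedF_translate_block`:
if `S` is covariant under block vectors `n•t`, `R` is block-periodic and `Ṙ` is block-covariant, then so is `SbfOf S cR R Ṙ`
(leaf-05-g3's `RjetOf_translate` BY NAME).  NOTE: `ReducedKernel.vertexRed_translate` as typed wants covariance under ALL fine
translations, which a block-periodic `R` does not give; the block twin is the right consumer. -/
theorem SbfOf_translate_block {n : ℕ} {S : Fin 4 → Site 4 → MKer 4 (Fib 3)} {cR : ℝ} {R : MKer 4 Unit}
    {Rd : Fin 4 → Site 4 → MKer 4 Unit}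
    (hS : ∀ (κ' : Fin 4) (u t : Site 4), S κ' (u + (n : ℤ) • t) = shiftK (-((n : ℤ) • t)) (S κ' u))
    (hRt : ∀ t : Site 4, shiftK (-((n : ℤ) • t)) R = R)
    (hRd : ∀ (κ' : Fin 4) (u t : Site 4), Rd κ' (u + (n : ℤ) • t) = shiftK (-((n : ℤ) • t)) (Rd κ' u))
    (κ' : Fin 4) (u t : Site 4) :
    SbfOf S cR R Rd κ' (u + (n : ℤ) • t) = shiftK (-((n : ℤ) • t)) (SbfOf S cR R Rd κ' u) := by
  have h1 := hS κ' u t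
  have hRt' : shiftK ((n : ℤ) • t) R = R := by simpa only [smul_neg, neg_neg] using hRt (-t)
  have h2 := RjetOf_translate κ' u ((n : ℤ) • t) hRt' (fun κ'' u' => hRd κ'' u' t) (R := R) (Rd := Rd)
  funext x z α β
  simp only [SbfOf_apply, Pi.add_apply, Pi.smul_apply, ffOf_apply, h1, h2, shiftK]

/-- [folklore] **ANTISYMMETRY** (the stripping convention of first-order stencils): if `S κ′ u` is antisymmetric on the packed fibre,
`R` is symmetric and each `Ṙ κ′ u` antisymmetric, then `SbfOf S cR R Ṙ κ′ u z x β α = −SbfOf S cR R Ṙ κ′ u x z α β`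
(leaf-05-g3's `RjetOf_antisymm` BY NAME). -/
theorem SbfOf_antisymm {S : Fin 4 → Site 4 → MKer 4 (Fib 3)} {cR : ℝ} {R : MKer 4 Unit} {Rd : Fin 4 → Site 4 → MKer 4 Unit}
    (hS : ∀ (κ' : Fin 4) (u x z : Site 4) (a b : Fib 3), S κ' u z x b a = -S κ' u x z a b)
    (hR : ∀ x z : Site 4, R z x () () = R x z () ())
    (hRd : ∀ (κ' : Fin 4) (u x z : Site 4), Rd κ' u z x () () = -Rd κ' u x z () ())
    (κ' : Fin 4) (u x z : Site 4) (α β : Fin 4) :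
    SbfOf S cR R Rd κ' u z x β α = -SbfOf S cR R Rd κ' u x z α β := by
  have h1 := ffOf_antisymm (hS κ' u) x z α β
  have h2 := RjetOf_antisymm κ' u hR hRd x z α β
  simp only [SbfOf_apply, Pi.add_apply, Pi.smul_apply, smul_eq_mul] at h1 h2 ⊢
  rw [h1, h2]
  ring

/-! ## §3 The road instance `Sbf` (E- and Λ-sectors by name through an2's `S₀`) -/

variable (n : ℕ) [NeZero n]

/-- [our object] **THE BF-x FIRST-ORDER FINE STENCIL** `Sbf n cE cVH cΛ cR R Ṙ := SbfOf (S0 3 n cE cVH cΛ) cR R Ṙ`: the ff-blocks of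
an2's level-0 bordered stencil `S₀ = cE • wilsonA + cVH • mfNeg vhS + cΛ • SLam n (lamCoeffOf (KInv n) n) (hessFF n)` plus the R-jet
sector.  The J6 sector is NOT included in v1 (module docstring).  A definition asserting nothing. -/
def Sbf (cE cVH cΛ cR : ℝ) (R : MKer 4 Unit) (Rd : Fin 4 → Site 4 → MKer 4 Unit) : StencilR :=
  SbfOf (S0 3 n cE cVH cΛ) cR R Rd

variable {n}

/-- [our object] Unfolding `Sbf`. -/
theorem Sbf_def (cE cVH cΛ cR : ℝ) (R : MKer 4 Unit) (Rd : Fin 4 → Site 4 → MKer 4 Unit) :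
    Sbf n cE cVH cΛ cR R Rd = SbfOf (S0 3 n cE cVH cΛ) cR R Rd := rfl

/-- [folklore] **THE THREE SECTORS**: `Sbf = cE • ff(wilsonA) + cΛ • ff(SLam n (lamCoeffOf (KInv n) n) (hessFF n)) + cR • RjetOf R Ṙ` —
the VH sector drops out (`ffOf_mfNeg_vhS`). -/
theorem Sbf_eq_sectors (cE cVH cΛ cR : ℝ) (R : MKer 4 Unit) (Rd : Fin 4 → Site 4 → MKer 4 Unit) (κ' : Fin 4) (u : Site 4) :
    Sbf n cE cVH cΛ cR R Rd κ' u =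
      cE • ffOf (wilsonA 3 κ' u) +
        cΛ • ffOf (SLam n (lamCoeffOf (KInv (N := n) (d := 3)) n) (fun μ y => hessFF n μ y) κ' u) + cR • RjetOf R Rd κ' u := by
  funext x z α β
  have h0 : mfNeg (vhS 3 n κ' u) x z (Sum.inl α) (Sum.inl β) = 0 := by
    rw [StepJetData.mfNeg_inl_inl]
    simp only [vhS, AveragingHessianKernels.packVH_inl_inl]
  simp only [Sbf_def, SbfOf_apply, S0, Pi.add_apply, Pi.smul_apply, smul_eq_mul, ffOf_apply, h0, mul_zero, add_zero]

/-- [folklore] `Sbf` does not depend on the VH coupling `cVH`. -/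
theorem Sbf_indep_cVH (cE cVH cVH' cΛ cR : ℝ) (R : MKer 4 Unit) (Rd : Fin 4 → Site 4 → MKer 4 Unit) :
    Sbf n cE cVH cΛ cR R Rd = Sbf n cE cVH' cΛ cR R Rd := by
  funext κ' u
  rw [Sbf_eq_sectors, Sbf_eq_sectors]

/-- [folklore] **SOCKET 1 for the road instance**: for `1 ≤ n` and J5 data bi-localised at some rate `δR > 0`, `Sbf` is a
bi-localised family at SOME rate `0 < δ ≤ δR` (an2's `locStencil_S0` for the E/VH/Λ sectors, `biLoc_RjetOf` for the R sector,
rates matched by `biLoc_anti`/`decays_anti`). -/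
theorem exists_biLoc_Sbf (hn : 1 ≤ n) (cE cVH cΛ cR : ℝ) {R : MKer 4 Unit} {Rd : Fin 4 → Site 4 → MKer 4 Unit} {C C' δR : ℝ}
    (hδR : 0 < δR) (hR : Decays R C δR) (hRd : ∀ κ' u, BiLoc (Rd κ' u) u u C' δR) :
    ∃ Cs δ : ℝ, 0 < δ ∧ δ ≤ δR ∧ ∀ κ' u, BiLoc (Sbf n cE cVH cΛ cR R Rd κ' u) u u Cs δ := by
  obtain ⟨Cs, δ₀, hδ₀, hS⟩ := locStencil_S0 (d := 3) (Lc := n) hn cE cVH cΛ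
  refine ⟨Cs + |cR| * (4 * (C + C') * Real.exp (2 * min δ₀ δR)), min δ₀ δR, lt_min hδ₀ hδR, min_le_right _ _, fun κ' u => ?_⟩
  exact biLoc_SbfOf (le_min hδ₀.le hδR.le) (fun κ'' u' => biLoc_anti (hS κ'' u') (min_le_left _ _))
    (decays_anti hR (min_le_right _ _)) (fun κ'' u' => biLoc_anti (hRd κ'' u') (min_le_right _ _)) κ' u

/-- [folklore] **SOCKET 2 for the road instance**: block covariance of `Sbf` (an2's `S0_translate`, leaf-05-g3's `RjetOf_translate`). -/
theorem Sbf_translate_block (hn : 1 ≤ n) (cE cVH cΛ cR : ℝ) {R : MKer 4 Unit} {Rd : Fin 4 → Site 4 → MKer 4 Unit}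
    (hRt : ∀ t : Site 4, shiftK (-((n : ℤ) • t)) R = R)
    (hRd : ∀ (κ' : Fin 4) (u t : Site 4), Rd κ' (u + (n : ℤ) • t) = shiftK (-((n : ℤ) • t)) (Rd κ' u))
    (κ' : Fin 4) (u t : Site 4) :
    Sbf n cE cVH cΛ cR R Rd κ' (u + (n : ℤ) • t) = shiftK (-((n : ℤ) • t)) (Sbf n cE cVH cΛ cR R Rd κ' u) :=
  SbfOf_translate_block (fun κ'' u' t' => S0_translate (d := 3) hn cE cVH cΛ κ'' u' t') hRt hRd κ' u t

/-- [folklore] **ANTISYMMETRY of the road instance** (an2's `S0_antisymm`, leaf-05-g3's `RjetOf_antisymm`). -/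
theorem Sbf_antisymm (cE cVH cΛ cR : ℝ) {R : MKer 4 Unit} {Rd : Fin 4 → Site 4 → MKer 4 Unit}
    (hR : ∀ x z : Site 4, R z x () () = R x z () ())
    (hRd : ∀ (κ' : Fin 4) (u x z : Site 4), Rd κ' u z x () () = -Rd κ' u x z () ())
    (κ' : Fin 4) (u x z : Site 4) (α β : Fin 4) :
    Sbf n cE cVH cΛ cR R Rd κ' u z x β α = -Sbf n cE cVH cΛ cR R Rd κ' u x z α β :=
  SbfOf_antisymm (fun κ'' u' x' z' a b => S0_antisymm (d := 3) (Lc := n) cE cVH cΛ κ'' u' x' z' a b) hR hRd κ' u x z α β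

/-! ## §4 The T8 plugs: the reduced vertex family of `Sbf` -/

/-- [folklore] **T8 PLUG 1**: the reduced vertex family `vertexRed n (Sbf …)` is a `VertexFamily` at SOME rate
(T8's `vertexFamily_vertexRed′` on SOCKET 1). -/
theorem exists_vertexFamily_vertexRed_Sbf (hn : 1 ≤ n) (cE cVH cΛ cR : ℝ) {R : MKer 4 Unit}
    {Rd : Fin 4 → Site 4 → MKer 4 Unit} {C C' δR : ℝ} (hδR : 0 < δR) (hR : Decays R C δR)
    (hRd : ∀ κ' u, BiLoc (Rd κ' u) u u C' δR) :
    ∃ Cv δv : ℝ, 0 < δv ∧ VertexFamily (vertexRed n (Sbf n cE cVH cΛ cR R Rd)) n Cv δv := by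
  obtain ⟨Cs, δ, hδ, -, hS⟩ := exists_biLoc_Sbf hn cE cVH cΛ cR hδR hR hRd
  obtain ⟨Cv, δv, hδv, -, hV⟩ := vertexFamily_vertexRed' n hS hδ
  exact ⟨Cv, δv, hδv, hV⟩

/-- [folklore] **T8 PLUG 2**: block covariance of the reduced vertex of `Sbf` (leaf-04's `vertexRedF_translate_block` on SOCKET 2;
`vertexRed = vertexRedF` by `rfl`). -/
theorem vertexRed_Sbf_translate (hn : 1 ≤ n) (cE cVH cΛ cR : ℝ) {R : MKer 4 Unit} {Rd : Fin 4 → Site 4 → MKer 4 Unit}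
    (hRt : ∀ t : Site 4, shiftK (-((n : ℤ) • t)) R = R)
    (hRd : ∀ (κ' : Fin 4) (u t : Site 4), Rd κ' (u + (n : ℤ) • t) = shiftK (-((n : ℤ) • t)) (Rd κ' u))
    (μ : Fin 4) (y t : Site 4) :
    vertexRed n (Sbf n cE cVH cΛ cR R Rd) μ (y + t) = shiftK (-((n : ℤ) • t)) (vertexRed n (Sbf n cE cVH cΛ cR R Rd) μ y) :=
  vertexRedF_translate_block n (Sbf_translate_block hn cE cVH cΛ cR hRt hRd) μ y t

/-- [folklore] **T8 PLUG 3**: `BlockCovariant (Ga n a) (vertexRed n (Sbf …)) W n` for any block-covariant table `W`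
(leaf-04's `GluonLeg.blockCovariant_Ga`). -/
theorem blockCovariant_vertexRed_Sbf (hn : 1 ≤ n) (a cE cVH cΛ cR : ℝ) {R : MKer 4 Unit}
    {Rd : Fin 4 → Site 4 → MKer 4 Unit} (hRt : ∀ t : Site 4, shiftK (-((n : ℤ) • t)) R = R)
    (hRd : ∀ (κ' : Fin 4) (u t : Site 4), Rd κ' (u + (n : ℤ) • t) = shiftK (-((n : ℤ) • t)) (Rd κ' u))
    {W : Fin 4 → Site 4 → Fin 4 → Site 4 → MKer 4 (Fin 4)}
    (hW : ∀ (μ : Fin 4) (y : Site 4) (ν : Fin 4) (y' t : Site 4), W μ (y + t) ν (y' + t) = shiftK (-((n : ℤ) • t)) (W μ y ν y')) :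
    BlockCovariant (Ga n a) (vertexRed n (Sbf n cE cVH cΛ cR R Rd)) W n :=
  blockCovariant_Ga n a hn (fun μ y t => vertexRed_Sbf_translate hn cE cVH cΛ cR hRt hRd μ y t) hW

end Summit.QuantumFields.BalabanUV.Beta.D1BFx.FineStencilBF

end
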